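import Summits.Ventures.PercRepro.C025ProfileStarIndep
import Summits.Ventures.PercRepro.C025ProfileStarDem
import Summits.Ventures.PercRepro.C025ProfileFourReduce
/-!
# THE ROW `(2,u)` OF THE PROFILE INEQUALITY FOR EVERY FINITE MATROID, MODULO `(Cap)` OF `E*_u` ON THE DEPENDENT
RANK-`u` SETS OF SIMPLE MATROIDS OF RANK `≥ u + 1` (night-3 g11)
`proofs/NIGHT3-G11-ESTAR.md`. For every `u ≥ 3`: rank `< u` is the empty level (`profileIneq_of_eRank_lt`), rank `u`
the top level (`Profile.profileIneq_top`), a non-simple matroid reduces to its simplification by the row reduction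
`profileIneq_row_of_simple` with the row `(1, u−1)` (`profileIneq_one_all`), and on a simple matroid of rank `≥ u + 1`
the rule `E*_u` is a certificate as soon as it satisfies `(Cap)` on the DEPENDENT rank-`u` sets (`CapStarDep`):
`(Cap)` on the independent ones is `cap_wEstar_of_card_eq` and `(Dem)` is `dem_wEstar`, both by construction. So
**`profileIneq_two_of_capStarDep`**: `CapStarDep` on simple matroids of rank `≥ u + 1` ⟹ `Profile.ProfileIneq M 2 u`
for EVERY finite matroid `M`; the Hall form `(H⁺_{2,u})` on simple matroids of rank `≥ u + 1` follows the same way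
(`hallIneq_two_of_capStarDep_of_rank`). The exact checker reports `CapStarDep` with 0 violations at `u = 3 … 7` on ≈ 20,000
simple matroids; for each `u` it is the one statement left for the row.
-/
open scoped Matroid
namespace PercRepro
open Set Finset ThmH
namespace EStar
variable {α : Type} [DecidableEq α]

variable (M : Matroid α) [M.Finite] (u : ℕ) in
/-- `(Cap)` of rule `E*_u` on the DEPENDENT rank-`u` sets of `M`: every rank-`u` set with more than `u` points
receives at most `1`. -/
def CapStarDep : Prop :=
  ∀ S ∈ Shadow.levelSet M u, u < S.card →
    ∑ B ∈ (Profile.Rq M 2).filter (fun B => B ⊆ S), wEstar M u B S ≤ 1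

variable {M : Matroid α} [M.Finite] {u : ℕ}

omit [DecidableEq α] in
/-- A rank-`u` set has at least `u` points. -/
theorem le_card_of_mem_levelSet {S : Finset α} (hS : S ∈ Shadow.levelSet M u) : u ≤ S.card := by
  obtain ⟨_, hSu⟩ := Profile.mem_levelSet.1 hS
  have h := M.eRk_le_encard (S : Set α)
  rw [hSu, Set.encard_coe_eq_coe_finsetCard] at h
  exact_mod_cast h

/-- `(Cap)` on every rank-`u` set from `(Cap)` on the dependent ones (the independent ones are by construction). -/
theorem cap_wEstar_of_capStarDep (hu : 2 ≤ u) (h : CapStarDep M u) :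
    ∀ S ∈ Shadow.levelSet M u, ∑ B ∈ (Profile.Rq M 2).filter (fun B => B ⊆ S), wEstar M u B S ≤ 1 := by
  intro S hS
  rcases lt_or_ge u S.card with hlt | hge
  · exact h S hS hlt
  · exact cap_wEstar_of_card_eq hu hS (le_antisymm hge (le_card_of_mem_levelSet hS))

/-- On a simple matroid of rank `≥ u + 1`, `CapStarDep` makes `E*_u` a certificate of the row `(2,u)`. -/
theorem profileIneq_two_of_capStarDep_of_rank (hu : 3 ≤ u) (hR : (u : ℕ∞) + 1 ≤ M.eRank)
    (h : CapStarDep M u) : Profile.ProfileIneq M 2 u :=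
  profileIneq_of_cert (M := M) 2 u (wEstar M u) (cap_wEstar_of_capStarDep (by omega) h)
    (fun _ hB => dem_wEstar hR hu hB)

/-- On a simple matroid of rank `≥ u + 1`, `CapStarDep` gives the Hall form `(H⁺_{2,u})` as well. -/
theorem hallIneq_two_of_capStarDep_of_rank (hu : 3 ≤ u) (hR : (u : ℕ∞) + 1 ≤ M.eRank)
    (h : CapStarDep M u) : Profile.HallIneq M 2 u :=
  hallIneq_of_cert (M := M) 2 u (wEstar M u) (fun B S => wEstar_nonneg B S)
    (cap_wEstar_of_capStarDep (by omega) h) (fun _ hB => dem_wEstar hR hu hB)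

/-- `(Π_{2,u})` on a simple matroid, given it in rank `≥ u + 1` (the lower ranks are the empty and top levels). -/
theorem profileIneq_two_of_simple_of_rank (N : Matroid α) [N.Finite]
    (hhigh : (u : ℕ∞) + 1 ≤ N.eRank → Profile.ProfileIneq N 2 u) : Profile.ProfileIneq N 2 u := by
  have hRtop : N.eRank ≠ ⊤ := N.eRank_ne_top_iff.2 inferInstance
  obtain ⟨R, hRe⟩ := ENat.ne_top_iff_exists.1 hRtop
  rcases Nat.lt_or_ge R u with hlt | hge
  · apply profileIneq_of_eRank_lt
    rw [← hRe]; exact_mod_cast hlt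
  rcases Nat.lt_or_ge R (u + 1) with hlt1 | hge1
  · have heq : R = u := by omega
    exact Profile.profileIneq_top (R := u) (by rw [← hRe, heq]) 2
  · apply hhigh
    rw [← hRe]
    have : ((u + 1 : ℕ) : ℕ∞) ≤ (R : ℕ∞) := by exact_mod_cast hge1
    rw [Nat.cast_succ] at this
    exact this

/-- **THE ROW `(2,u)` FOR EVERY FINITE MATROID REDUCES TO `CapStarDep` ON SIMPLE MATROIDS OF RANK `≥ u + 1`**
(`u ≥ 3`): `(Dem)` and `(Cap)` on the independent sets hold by construction, rank `< u` / `= u` are the empty / top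
levels, and a non-simple matroid reduces to its simplification with the row `(1, u−1)`. -/
theorem profileIneq_two_of_capStarDep (hu : 3 ≤ u)
    (hcap : ∀ (N : Matroid α) [N.Finite], (∀ T ⊆ N.E, T.encard ≤ 2 → N.Indep T) → (u : ℕ∞) + 1 ≤ N.eRank →
      CapStarDep N u)
    (M : Matroid α) [M.Finite] : Profile.ProfileIneq M 2 u := by
  obtain ⟨v, rfl⟩ : ∃ v, u = v + 1 := ⟨u - 1, by omega⟩
  exact profileIneq_row_of_simple (q := 1) (u := v) (by omega)
    (fun N _ hs => profileIneq_two_of_simple_of_rank N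
      (fun hR => profileIneq_two_of_capStarDep_of_rank hu hR (hcap N hs hR)))
    (fun N _ => profileIneq_one_all N v (by omega)) M

end EStar
end PercRepro
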